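import Literature.NumberTheory.GaloisRepresentations.ContinuousCorestriction
import HarnessLib

/-!
# Corestriction commutes with transport along an isomorphism of topological groups

Topic `NumberTheory/GaloisRepresentations` (generic continuous group cohomology); namespace
`Literature.NumberTheory.GaloisRepresentations`.  Theorems only (no definition, no named fact).

For a bijective continuous homomorphism `θ : G' → G` of topological groups, an open subgroup `N ≤ G` of
finite index with preimage `N' = θ⁻¹(N) ≤ G'`, topological modules `X` of `G`, `X'` of `G'` and a
compatible map `f : res θ X ⟶ X'` (`f (θ g' • m) = g' • f m`), the pull-backs
`Hⁿ(θ, f) : H¹(G, X) → H¹(G', X')` and `H¹(θ|_{N'}, f) : H¹(N, X) → H¹(N', X')` intertwine the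
corestrictions of the tree (`cores`, the transfer on continuous crossed homomorphisms):

  `cor_{G'/N'} (H¹(θ|_{N'}, f) y) = H¹(θ, f) (cor_{G/N} y)`      (`cores_map_eq_map_cores`).

On cocycles this is an equality for the representatives `s' = θ⁻¹ ∘ s ∘ θ̄` of `G' ⧸ N.comap (θ : G' →* G)` transported from
representatives `s` of `G ⧸ N` along the bijection `θ̄ : G' ⧸ N.comap (θ : G' →* G) ≃ G ⧸ N`.  (Serre, *Galois Cohomology*
I §2.4: `Cor` is functorial in compatible pairs; used to move `Cor_{K'_w/K_v}` from `Γ_{K_v}` to the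
decomposition group `D_v ≤ Γ_K`.)

## References
* J.-P. Serre, *Galois Cohomology* (1997), I §2.4. [SerreGaloisCohomology1997]
* J. Neukirch, A. Schmidt, K. Wingberg, *Cohomology of Number Fields* (2008), I §5 Prop. 1.5.4.
  [NeukirchSchmidtWingberg2008]
-/

noncomputable section

open CategoryTheory Function Finset

universe u v

namespace Literature.NumberTheory.GaloisRepresentations

open Literature.NumberTheory.EllipticCurves (schreierElt schreierElt_mem schreierElt_coe
  subgroupInclusion subgroupInclusion_apply_coe)

variable {R : Type u} [Ring R] [TopologicalSpace R]
variable {G G' : Type v} [Group G] [TopologicalSpace G] [IsTopologicalGroup G]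
  [Group G'] [TopologicalSpace G'] [IsTopologicalGroup G']

section Transport

variable (X : TopRep.{v} R G) (X' : TopRep.{v} R G') (θ : G' →ₜ* G) (hθ : Function.Bijective θ)
  (f : TopRep.res (θ : G' →* G) X ⟶ X') (N : Subgroup G) [Fintype (G ⧸ N)]
  [Fintype (G' ⧸ N.comap (θ : G' →* G))]

/-- The restriction `θ|_{N'} : N' = θ⁻¹(N) → N` of `θ`. [cite: SerreGaloisCohomology1997, I §2.4] -/
def comapRestrictHom : N.comap (θ : G' →* G) →ₜ* N where
  toFun n' := ⟨θ (n' : G'), n'.2⟩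
  map_one' := Subtype.ext (by simp)
  map_mul' a b := Subtype.ext (by simp)
  continuous_toFun := (θ.continuous.comp continuous_subtype_val).subtype_mk _

omit [IsTopologicalGroup G] [IsTopologicalGroup G'] [Fintype (G ⧸ N)]
  [Fintype (G' ⧸ N.comap (θ : G' →* G))] in
/-- Unfolding `comapRestrictHom`. [cite: SerreGaloisCohomology1997, I §2.4] -/
@[simp]
theorem comapRestrictHom_apply_coe (n' : N.comap (θ : G' →* G)) :
    ((comapRestrictHom θ N n' : N) : G) = θ (n' : G') := rfl

/-- The module map `f` read on the restricted representations: `res (θ|_{N'}) (X|N) ⟶ X'|N'`.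
[cite: SerreGaloisCohomology1997, I §2.4] -/
def comapRestrictRepHom :
    TopRep.res (comapRestrictHom θ N : N.comap (θ : G' →* G) →* N) (subgroupRep X N) ⟶
      subgroupRep X' (N.comap (θ : G' →* G)) :=
  TopRep.ofHom ⟨f.hom.toContinuousLinearMap, fun n' => by
    ext m
    exact TopRep.hom_comm_apply f (n' : G') m⟩

include hθ in
/-- **Corestriction commutes with transport along a bijective continuous homomorphism**:
`cor_{G'/θ⁻¹N} (H¹(θ|, f) y) = H¹(θ, f) (cor_{G/N} y)` for the tree's `cores`.
[cite: SerreGaloisCohomology1997, I §2.4] [cite: NeukirchSchmidtWingberg2008, I §5 Prop. 1.5.4] -/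
theorem cores_map_eq_map_cores (hN : IsOpen (N : Set G))
    (hN' : IsOpen ((N.comap (θ : G' →* G) : Subgroup G') : Set G'))
    (y : continuousCohomology 1 (subgroupRep X N)) :
    cores X' (N.comap (θ : G' →* G)) hN'
        (ContinuousCohomology.map (comapRestrictHom θ N) (comapRestrictRepHom X X' θ f N) 1 y) =
      ContinuousCohomology.map θ f 1 (cores X N hN y) := by
  classical
  obtain ⟨φ, rfl⟩ := oneCocycleClass_surjective _ y
  -- the inverse of `θ` and the induced bijection of coset spaces
  set e : G' ≃ G := Equiv.ofBijective θ hθ with he_def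
  have he : ∀ g', e g' = θ g' := fun _ => rfl
  have hθe : ∀ g, θ (e.symm g) = g := fun g => by rw [← he, Equiv.apply_symm_apply]
  -- representatives of `G ⧸ N` and the transported representatives of `G' ⧸ N.comap (θ : G' →* G)`
  set s : G ⧸ N → G := Quotient.out with hs_def
  have hs : ∀ x : G ⧸ N, (s x : G ⧸ N) = x := QuotientGroup.out_eq'
  -- `θ̄ : G' ⧸ N.comap (θ : G' →* G) → G ⧸ N`
  set θbar : G' ⧸ N.comap (θ : G' →* G) → G ⧸ N := Quotient.map' (fun g' => θ g') (fun a b h => by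
    rw [QuotientGroup.leftRel_apply] at h ⊢
    rw [← map_inv, ← map_mul]
    exact h) with hθbar_def
  have hθbar : ∀ g' : G', θbar (g' : G' ⧸ N.comap (θ : G' →* G)) = ((θ g' : G) : G ⧸ N) := fun _ => rfl
  have hθbar_bij : Function.Bijective θbar := by
    constructor
    · intro a b hab
      induction a using QuotientGroup.induction_on with
      | H a =>
        induction b using QuotientGroup.induction_on with
        | H b =>
          rw [hθbar, hθbar, QuotientGroup.eq] at hab
          apply QuotientGroup.eq.mpr
          change θ (a⁻¹ * b) ∈ N
          rwa [map_mul, map_inv]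
    · intro x
      induction x using QuotientGroup.induction_on with
      | H g => exact ⟨(e.symm g : G'), by rw [hθbar, hθe]⟩
  set ebar : G' ⧸ N.comap (θ : G' →* G) ≃ G ⧸ N := Equiv.ofBijective θbar hθbar_bij with hebar_def
  set s' : G' ⧸ N.comap (θ : G' →* G) → G' := fun x' => e.symm (s (ebar x')) with hs'_def
  have hs' : ∀ x' : G' ⧸ N.comap (θ : G' →* G), (s' x' : G' ⧸ N.comap (θ : G' →* G)) = x' := fun x' => by
    induction x' using QuotientGroup.induction_on with
    | H a =>
      refine (QuotientGroup.eq.mpr ?_).symm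
      change θ (a⁻¹ * e.symm (s (ebar (a : G' ⧸ N.comap (θ : G' →* G))))) ∈ N
      rw [map_mul, map_inv, hθe]
      have h1 : ebar (a : G' ⧸ N.comap (θ : G' →* G)) = ((θ a : G) : G ⧸ N) := hθbar a
      rw [h1]
      exact QuotientGroup.eq.mp (hs _).symm
  -- `θ` of the transported Schreier elements
  have hsmul : ∀ (g' : G') (x' : G' ⧸ N.comap (θ : G' →* G)), ebar (g' • x') = θ g' • ebar x' := fun g' x' => by
    induction x' using QuotientGroup.induction_on with
    | H a =>
      change θbar ((g' * a : G') : G' ⧸ N.comap (θ : G' →* G)) = θ g' • θbar (a : G' ⧸ N.comap (θ : G' →* G))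
      rw [hθbar, hθbar, map_mul, MulAction.Quotient.smul_coe, smul_eq_mul]
  have hschreier : ∀ (g' : G') (x' : G' ⧸ N.comap (θ : G' →* G)),
      θ ((schreierElt (N.comap (θ : G' →* G)) hs' g' x' : N.comap (θ : G' →* G)) : G') = ((schreierElt N hs (θ g') (ebar x') : N) : G) := fun g' x' => by
    rw [schreierElt_coe, schreierElt_coe, map_mul, map_mul, map_inv, hs'_def]
    dsimp only
    rw [hθe, hθe, hsmul]
  -- `f` intertwines
  have hf : ∀ (g : G') (m : X), f.hom (X.ρ (θ g) m) = X'.ρ g (f.hom m) := fun g m =>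
    TopRep.hom_comm_apply f g m
  -- both sides as classes of explicit cocycles on `G'`
  rw [map_oneCocycleClass, cores_oneCocycleClass X' _ hN' hs', cores_oneCocycleClass X N hN hs,
    map_oneCocycleClass]
  refine congrArg _ (Subtype.ext (ContinuousMap.ext fun g' => ?_))
  rw [transferCocycle_apply, contOneCocycles.pullback_apply, transferCocycle_apply, transferFun_apply,
    transferFun_apply, map_sum, ← ebar.sum_comp]
  refine Finset.sum_congr rfl fun x' _ => ?_
  rw [contOneCocycles.pullback_apply, ← hsmul, ← hθe (s (ebar (g' • x'))), hf]
  change X'.ρ (e.symm (s (ebar (g' • x')))) (f.hom (φ.1 _)) =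
    X'.ρ (e.symm (s (ebar (g' • x')))) (f.hom (φ.1 _))
  congr 3
  exact Subtype.ext (hschreier g' x')

end Transport

end Literature.NumberTheory.GaloisRepresentations

end
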